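import Summits.MatrixMultiplication.MatrixMultiplication.Theorems.SoloInformedTwistedMatchings
import Literature.Barriers.MatrixMultiplication.NilpotentGroupBarrierPStraighten
import Literature.Barriers.MatrixMultiplication.NilpotentGroupBarrierPSeries
import Literature.Barriers.MatrixMultiplication.NilpotentGroupBarrierPCounting
import HarnessLib

/-!
# Twisted matchings for arbitrary automorphism twists: the Jennings filtration is `Aut`-stable

Solo-informed seat (MatrixMultiplication), gen 101; sequel of `SoloInformedTwistedMatchings.lean`.
There the twists had to act coordinatewise (Sawin's basis of `K[H^T]` is not stable under
`GL`); here we treat ARBITRARY automorphism twists of an elementary abelian `p`-group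
`S ≅ 𝔽_p^k` — i.e. every translation scheme `𝒮(𝔽_p^k, M₀)`, `M₀ ≤ GL_k(𝔽_p)` (Cohn–Umans 2013,
§5), and more generally every finite family of pairs of automorphisms — by using the Jennings basis
(`PCGS.gradedCoords` of the tree, BCCGU 2017 Prop. 3.10) instead: its filtration
`M_d = span{u^e : |e| ≥ d} = I^d` (powers of the augmentation ideal) is stable under the algebra
endomorphism of `K[S]` induced by ANY group endomorphism, which is exactly the filteredness
hypothesis of the twisted codimension bound `card_le_of_twistedMatching`.

* `pcgs_of_sub_one_mem_M_one` — `x - 1 ∈ M_1` for every `x ∈ S` (augmentation argument);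
  `pcgs_mapDomain_mem_M` — for a `p`-central generating system with ONE level, the push-forward
  along a group endomorphism maps `M_d` into `M_d`; `pcgs_pushforward_filtered` — hence the
  `β_j`-coordinate of `φ_*(β_{j'})` vanishes for `deg j < deg j'`.
* `card_le_of_autTwistedMatching` — the twisted codimension bound in the Jennings coordinates;
  `exists_autTwistedMatching_card_le` — WEIGHT-FREE, FIELD-FREE form: for every prime `p` there is
  `δ > 0` such that for every finite abelian group `S` of exponent `p`, all families of
  automorphism pairs `(φ_s, ψ_s)_{s ∈ σ}` and all `(x_i, y_i, z_i)_{i ∈ ι}` in `S^3` with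
  `(∃ s, x_i φ_s(y_j) ψ_s(z_l) = 1) ⟺ i = j = l`, one has `|ι| ≤ 3 |S|^{1-δ}`.
* `realization_autTwisted_inducedMatching_card_le` — consequently a realization of `⟨n,n,n⟩`
  (Cohn–Umans 2013, Def. 12) by the twisted triangle predicate forces every induced matching of
  the matrix-multiplication support to have `≤ 3 |S|^{1-δ}` elements; with the Behrend-type lower
  bound `n^{2-o(1)}` for such induced matchings this is the slice-rank half of the seat's
  Theorem B″ (sharpest-statement §2y(8)): translation schemes of `𝔽_p^k`, whatever `M₀`, do not
  carry Cohn–Umans Conj. 21 in bounded characteristic.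

References: BlasiakChurchCohnGrochowUmans2017 (arXiv:1712.02302) Prop. 3.2, Def. 3.5, Prop. 3.10;
BlasiakChurchCohnGrochowNaslundSawinUmans2017 Prop. 4.8; CohnUmans2013 (arXiv:1207.6528) Def. 12,
§5, Conj. 21; S. A. Jennings, Trans. AMS 50 (1941).
-/

noncomputable section

open scoped BigOperators
open Finset Literature.Combinatorics.Additive Literature.Barriers.MatrixMultiplication

namespace Summit.MatrixMultiplication.MatrixMultiplication.Theorems.TwistedSliceRank

universe u' v' w'

section Jennings

variable {p : ℕ} {S : Type u'} [Group S] {ι : Type w'} [LinearOrder ι] [Fintype ι]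
  (C : PCGS p S ι) {K : Type v'} [Field K]

/-- With one level all letters have weight `1`. [folklore] -/
theorem pcgs_W_eq_one (hL : C.L = 1) (a : ι) : C.W a = 1 := by
  have h : C.lvl a = 0 := by have := C.lvl_lt a; omega
  simp [PCGS.W, h]

/-- With one level the weight of a word is its length. [folklore] -/
theorem pcgs_wt_eq_length (hL : C.L = 1) (w : List ι) : C.wt w = w.length := by
  unfold PCGS.wt
  rw [List.map_congr_left (fun a _ => pcgs_W_eq_one C hL a)]
  simp

/-- The augmentation kills the letters `u_a = gen(a) - 1`. [folklore] -/
theorem pcgs_aug_u (a : ι) : MonoidAlgebra.lift K K S (1 : S →* K) (C.u K a) = 0 := by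
  simp [PCGS.u]

/-- The augmentation kills every non-empty word. [folklore] -/
theorem pcgs_aug_eval {w : List ι} (hw : w ≠ []) :
    MonoidAlgebra.lift K K S (1 : S →* K) (C.eval K w) = 0 := by
  unfold PCGS.eval
  rw [map_list_prod, List.map_map]
  apply List.prod_eq_zero
  obtain ⟨a, ha⟩ := List.exists_mem_of_ne_nil w hw
  exact List.mem_map.2 ⟨a, ha, by simp [pcgs_aug_u]⟩

/-- `M_1 ⊆ ker(augmentation)`. [folklore] -/
theorem pcgs_aug_eq_zero_of_mem_M_one {f : MonoidAlgebra K S} (hf : f ∈ C.M K 1) :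
    MonoidAlgebra.lift K K S (1 : S →* K) f = 0 := by
  unfold PCGS.M at hf
  induction hf using Submodule.span_induction with
  | mem y hy =>
    obtain ⟨w, ⟨-, hw⟩, rfl⟩ := hy
    refine pcgs_aug_eval C ?_
    rintro rfl
    simp at hw
  | zero => simp
  | add y z _ _ hy hz => rw [map_add, hy, hz, add_zero]
  | smul r y _ hy => rw [map_smul, hy, smul_zero]

variable [Fact p.Prime] [CharP K p]

/-- `x - 1` lies in `M_1` (the augmentation ideal is spanned by the non-empty canonical words).
[folklore] -/
theorem pcgs_of_sub_one_mem_M_one (x : S) : MonoidAlgebra.of K S x - 1 ∈ C.M K 1 := by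
  have hle : C.M K 0 ≤ (K ∙ (1 : MonoidAlgebra K S)) ⊔ C.M K 1 := by
    unfold PCGS.M
    refine Submodule.span_le.2 ?_
    rintro _ ⟨w, ⟨hcan, -⟩, rfl⟩
    cases w with
    | nil =>
      refine Submodule.mem_sup_left ?_
      rw [PCGS.eval_nil]
      exact Submodule.mem_span_singleton_self _
    | cons a w' =>
      refine Submodule.mem_sup_right (Submodule.subset_span ⟨a :: w', ⟨hcan, ?_⟩, rfl⟩)
      rw [PCGS.wt_cons]
      exact (Nat.one_le_pow _ _ (Nat.succ_pos p)).trans (Nat.le_add_right _ _)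
  have hf : MonoidAlgebra.of K S x - 1 ∈ C.M K 0 := by
    rw [C.M_zero_eq_top]; exact Submodule.mem_top
  obtain ⟨y, hy, z, hz, hyz⟩ := Submodule.mem_sup.1 (hle hf)
  obtain ⟨c, rfl⟩ := Submodule.mem_span_singleton.1 hy
  have hc : c = 0 := by
    have e1 : MonoidAlgebra.lift K K S (1 : S →* K) (1 : MonoidAlgebra K S) = 1 := map_one _
    have e2 : MonoidAlgebra.lift K K S (1 : S →* K) (MonoidAlgebra.of K S x) = 1 := by
      rw [MonoidAlgebra.lift_of, MonoidHom.one_apply]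
    have h := congr_arg (MonoidAlgebra.lift K K S (1 : S →* K)) hyz
    rw [map_add, pcgs_aug_eq_zero_of_mem_M_one C hz, add_zero, map_smul, e1, map_sub, e2, e1,
      sub_self, smul_eq_mul, mul_one] at h
    exact h
  rw [hc, zero_smul, zero_add] at hyz
  rw [← hyz]
  exact hz

/-- A product of `n` elements of `M_1` lies in `M_n`. [folklore] -/
theorem pcgs_list_prod_mem_M (l : List (MonoidAlgebra K S)) (hl : ∀ f ∈ l, f ∈ C.M K 1) :
    l.prod ∈ C.M K l.length := by
  induction l with
  | nil => rw [List.prod_nil, List.length_nil, C.M_zero_eq_top]; exact Submodule.mem_top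
  | cons a l ih =>
    rw [List.prod_cons, List.length_cons, Nat.add_comm]
    exact C.M_mul_M_le 1 l.length
      (Submodule.mul_mem_mul (hl a (by simp)) (ih fun f hf => hl f (by simp [hf])))

/-- The push-forward of a word along a group endomorphism lies in `M_{length}`. [folklore] -/
theorem pcgs_mapDomain_eval_mem_M (φ : S →* S) (w : List ι) :
    MonoidAlgebra.mapDomainAlgHom K K φ (C.eval K w) ∈ C.M K w.length := by
  unfold PCGS.eval
  rw [map_list_prod, List.map_map]
  have h := pcgs_list_prod_mem_M C (w.map (⇑(MonoidAlgebra.mapDomainAlgHom K K φ) ∘ C.u K)) ?_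
  · simpa using h
  · intro f hf
    obtain ⟨a, -, rfl⟩ := List.mem_map.1 hf
    have hof : MonoidAlgebra.mapDomainAlgHom K K φ (MonoidAlgebra.of K S (C.gen a)) =
        MonoidAlgebra.of K S (φ (C.gen a)) := by
      simp [MonoidAlgebra.of_apply, MonoidAlgebra.mapDomain_single]
    simp only [Function.comp_apply, PCGS.u, map_sub, map_one, hof]
    exact pcgs_of_sub_one_mem_M_one C _

/-- **The Jennings filtration is stable under group endomorphisms** (one level, i.e. `S`
elementary abelian and `M_d = I^d`): `φ_*(M_d) ⊆ M_d`. [folklore] -/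
theorem pcgs_mapDomain_mem_M (hL : C.L = 1) (φ : S →* S) {d : ℕ} {f : MonoidAlgebra K S}
    (hf : f ∈ C.M K d) : MonoidAlgebra.mapDomainAlgHom K K φ f ∈ C.M K d := by
  unfold PCGS.M at hf
  induction hf using Submodule.span_induction with
  | mem y hy =>
    obtain ⟨w, ⟨-, hw⟩, rfl⟩ := hy
    refine C.M_anti ?_ (pcgs_mapDomain_eval_mem_M C φ w)
    rwa [← pcgs_wt_eq_length C hL]
  | zero => simp
  | add y z _ _ hy hz => rw [map_add]; exact Submodule.add_mem _ hy hz
  | smul r y _ hy => rw [map_smul]; exact Submodule.smul_mem _ r hy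

variable [Fintype S]

/-- `M_d` is spanned by the monomials of degree `≥ d`. [folklore] -/
theorem pcgs_M_le_span_basis (d : ℕ) :
    C.M K d ≤ Submodule.span K (C.basis K '' {k | d ≤ C.deg k}) := by
  unfold PCGS.M
  refine Submodule.span_mono ?_
  rintro _ ⟨w, ⟨⟨hsort, hcount⟩, hk⟩, rfl⟩
  refine ⟨fun a => ⟨w.count a, hcount a⟩, ?_, ?_⟩
  · show d ≤ C.deg fun a => (⟨w.count a, hcount a⟩ : Fin p)
    have : C.deg (fun a => (⟨w.count a, hcount a⟩ : Fin p)) = C.wt w := by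
      rw [← PCGS.wt_canon_expo]
      show C.wt (canonWord fun a => w.count a) = C.wt w
      rw [← eq_canonWord_count hsort]
    rw [this]
    exact hk
  · rw [PCGS.coe_basis]
    show C.eval K (canonWord fun a => (w.count a : ℕ)) = C.eval K w
    rw [← eq_canonWord_count hsort]

variable [DecidableEq S]

/-- **Filteredness of endomorphism twists in the Jennings coordinates**: for `deg j < deg j'` the
`β_j`-coordinate of `φ_*(β_{j'}) = Σ_{x'} P(j',x') δ_{φ x'}` vanishes. [folklore] -/
theorem pcgs_pushforward_filtered (hL : C.L = 1) (φ : S →* S) (j' j : ι → Fin p)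
    (h : C.deg j < C.deg j') :
    ∑ x', (C.gradedCoords K).P j' x' * (C.gradedCoords K).Q (φ x') j = 0 := by
  classical
  have hP : ∀ x', (C.gradedCoords K).P j' x' = ((C.basis K) j').coeff x' := fun _ => rfl
  have hQ : ∀ y, (C.gradedCoords K).Q y j = (C.basis K).repr (MonoidAlgebra.of K S y) j :=
    fun _ => rfl
  simp_rw [hP, hQ]
  have hexp : ∀ f : MonoidAlgebra K S, f = ∑ x, f.coeff x • MonoidAlgebra.of K S x := fun f => by
    apply MonoidAlgebra.coeff_injective
    rw [MonoidAlgebra.coeff_sum]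
    conv_lhs => rw [← Finsupp.univ_sum_single f.coeff]
    refine Finset.sum_congr rfl fun x _ => ?_
    rw [MonoidAlgebra.coeff_smul, MonoidAlgebra.of_apply, MonoidAlgebra.coeff_single,
      Finsupp.smul_single_one]
  have hΦ : MonoidAlgebra.mapDomainAlgHom K K φ ((C.basis K) j') =
      ∑ x, ((C.basis K) j').coeff x • MonoidAlgebra.of K S (φ x) := by
    conv_lhs => rw [hexp ((C.basis K) j')]
    rw [map_sum]
    refine Finset.sum_congr rfl fun x _ => ?_
    rw [map_smul]
    congr 1
    simp [MonoidAlgebra.of_apply, MonoidAlgebra.mapDomain_single]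
  have hcoord : (C.basis K).repr (MonoidAlgebra.mapDomainAlgHom K K φ ((C.basis K) j')) j =
      ∑ x, ((C.basis K) j').coeff x * (C.basis K).repr (MonoidAlgebra.of K S (φ x)) j := by
    rw [hΦ, map_sum, Finsupp.coe_finsetSum, Finset.sum_apply]
    refine Finset.sum_congr rfl fun x _ => ?_
    rw [map_smul, Finsupp.smul_apply, smul_eq_mul]
  rw [← hcoord]
  have hmem : MonoidAlgebra.mapDomainAlgHom K K φ ((C.basis K) j') ∈ C.M K (C.deg j') := by
    refine pcgs_mapDomain_mem_M C hL φ ?_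
    rw [PCGS.coe_basis]
    show C.eval K (canonWord fun a => ((j' a : Fin p) : ℕ)) ∈ C.M K (C.deg j')
    refine C.M_anti (le_of_eq (C.wt_canon_expo j').symm) (C.eval_mem_M _)
  have hsub := (C.basis K).repr_support_subset_of_mem_span _ (pcgs_M_le_span_basis C _ hmem)
  by_contra hne
  have hj := hsub (Finsupp.mem_support_iff.2 hne)
  simp only [Set.mem_setOf_eq] at hj
  omega

/-- **Twisted codimension bound in the Jennings coordinates**: for `S` with a one-level
`p`-central generating system (`S` elementary abelian), `char K = p`, weights `t` and
AUTOMORPHISM twists `(φ_s, ψ_s)`, a weighted twisted matching `(x_i, y_i, z_i)_{i ∈ ι'}`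
(off-diagonal: no twist solves `x_i φ_s(y_j) ψ_s(z_l) = 1`; diagonal: the weighted number of
solving twists is non-zero) has `|ι'| ≤ #{deg < a} + #{deg < b} + #{deg ≥ a + b}`.
[this work] -/
theorem card_le_of_autTwistedMatching (hL : C.L = 1) {σ : Type*} [Fintype σ] (t : σ → K)
    (φ ψ : σ → S ≃* S) {ι' : Type*} [Fintype ι'] (x y z : ι' → S)
    (hoff : ∀ (i j l : ι') (s : σ), x i * φ s (y j) * ψ s (z l) = 1 → i = j ∧ j = l)
    (hdiag : ∀ i : ι', (∑ s, t s * (if x i * φ s (y i) * ψ s (z i) = 1 then (1 : K) else 0)) ≠ 0)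
    (a b : ℕ) :
    Fintype.card ι' ≤ Fintype.card {e : ι → Fin p // C.deg e < a} +
      Fintype.card {e : ι → Fin p // C.deg e < b} +
      Fintype.card {e : ι → Fin p // a + b ≤ C.deg e} := by
  classical
  have h := card_le_of_twistedMatching (C.gradedCoords K) t (fun s g => φ s g) (fun s g => ψ s g)
    ?_ ?_ x y z hoff hdiag a b
  · convert h using 4 <;> rfl
  · intro s j' j hlt
    have := pcgs_pushforward_filtered C (K := K) hL ((φ s : S ≃* S) : S →* S) j' j
      (by simpa only [PCGS.gradedCoords_deg] using hlt)
    simpa using this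
  · intro s k k' hlt
    have h1 : ∀ b : S, (ψ s b⁻¹)⁻¹ = ψ s b := fun b => by rw [map_inv, inv_inv]
    simp_rw [h1]
    have := pcgs_pushforward_filtered C (K := K) hL (((ψ s).symm : S ≃* S) : S →* S) k k'
      (by simpa only [PCGS.gradedCoords_deg] using hlt)
    rw [show (∑ b, (C.gradedCoords K).P k (ψ s b) * (C.gradedCoords K).Q b k') =
        ∑ x', (C.gradedCoords K).P k x' * (C.gradedCoords K).Q ((ψ s).symm x') k' from
      Fintype.sum_equiv (ψ s).toEquiv _ _ (fun b => by simp)]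
    simpa using this

end Jennings

section WeightFree

/-- **Twisted matchings with arbitrary automorphism twists are polynomially small** (weight-free,
field-free). For every prime `p` there is `δ > 0` such that: for every finite abelian group `S` of
exponent `p` (so `S ≅ 𝔽_p^k`), every finite family of pairs of automorphisms `(φ_s, ψ_s)` (e.g.
the scalar pairs `M₀ × M₀`, `M₀ ≤ GL_k(𝔽_p)`, of a translation scheme `𝒮(𝔽_p^k, M₀)`), and every
family `(x_i, y_i, z_i)_{i ∈ ι}` in `S^3` with `(∃ s, x_i φ_s(y_j) ψ_s(z_l) = 1) ⟺ i = j = l`, one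
has `|ι| ≤ 3 |S|^{1-δ}`. (PCGS with one level from `exists_pcgs`; field `Frac(𝔽_p[X])`; weights
`exists_weights`; `card_le_of_autTwistedMatching` at the threshold of `exists_tail_decay`.)
[this work] -/
theorem exists_autTwistedMatching_card_le (p : ℕ) [hp : Fact p.Prime] :
    ∃ δ : ℝ, 0 < δ ∧ ∀ (S : Type) [CommGroup S] [Fintype S] [DecidableEq S],
      (∀ g : S, g ^ p = 1) →
      ∀ (σ : Type) [Fintype σ] (φ ψ : σ → S ≃* S) (ι : Type) [Fintype ι] (x y z : ι → S),
      (∀ i j l : ι, (∃ s : σ, x i * φ s (y j) * ψ s (z l) = 1) ↔ (i = j ∧ j = l)) →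
      (Fintype.card ι : ℝ) ≤ 3 * (Fintype.card S : ℝ) ^ (1 - δ) := by
  classical
  have hp2 : 2 ≤ p := hp.out.two_le
  obtain ⟨ρ, hρ0, hρ1, hdecay⟩ := exists_tail_decay hp2 (Wmax := 1) le_rfl
  have hp1 : (1 : ℝ) < p := by exact_mod_cast hp.out.one_lt
  have hlogp : 0 < Real.log p := Real.log_pos hp1
  have hlogρ : Real.log ρ < 0 := Real.log_neg hρ0 hρ1
  set δ : ℝ := -Real.log ρ / Real.log p with hδ
  have hδ0 : 0 < δ := by rw [hδ]; exact div_pos (by linarith) hlogp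
  refine ⟨δ, hδ0, ?_⟩
  intro S _ _ _ hexpS σ _ φ ψ ι _ x y z hmatch
  -- a one-level `p`-central generating system
  have hexp : Monoid.exponent S ∣ p ^ 1 := by
    rw [pow_one]
    exact Monoid.exponent_dvd_iff_forall_pow_eq_one.2 hexpS
  obtain ⟨ιC, _, _, C, hCL⟩ :=
    exists_pcgs (p := p) (S := S) Nat.one_pos CommGroup.nilpotencyClass_le_one hexp
  have hL : C.L = 1 := by rw [hCL]
  -- the field and the weights
  have hinj : Function.Injective
      (algebraMap (Polynomial (ZMod p)) (FractionRing (Polynomial (ZMod p)))) :=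
    IsFractionRing.injective (Polynomial (ZMod p)) (FractionRing (Polynomial (ZMod p)))
  haveI : CharP (FractionRing (Polynomial (ZMod p))) p := charP_of_injective_algebraMap hinj p
  haveI : Infinite (FractionRing (Polynomial (ZMod p))) := Infinite.of_injective _ hinj
  let Sol : ι → Finset σ := fun i => Finset.univ.filter fun s => x i * φ s (y i) * ψ s (z i) = 1
  have hSol : ∀ i, (Sol i).Nonempty := fun i => by
    obtain ⟨s, hs⟩ := (hmatch i i i).2 ⟨rfl, rfl⟩
    exact ⟨s, by simp [Sol, hs]⟩
  obtain ⟨t, ht⟩ := exists_weights (K := FractionRing (Polynomial (ZMod p))) Sol hSol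
  have hdiag : ∀ i, (∑ s, t s * (if x i * φ s (y i) * ψ s (z i) = 1
      then (1 : FractionRing (Polynomial (ZMod p))) else 0)) ≠ 0 := by
    intro i
    have hsum : (∑ s, t s * (if x i * φ s (y i) * ψ s (z i) = 1
        then (1 : FractionRing (Polynomial (ZMod p))) else 0)) = ∑ s ∈ Sol i, t s := by
      rw [Finset.sum_filter]
      exact Finset.sum_congr rfl fun s _ => by split_ifs <;> simp
    rw [hsum]
    exact ht i
  -- the threshold and the codimension bound
  obtain ⟨tt, hlow, hhigh⟩ := hdecay ιC C.W (fun a => (pcgs_W_eq_one C hL a).ge)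
    (fun a => (pcgs_W_eq_one C hL a).le)
  have hcard := card_le_of_autTwistedMatching C (K := FractionRing (Polynomial (ZMod p))) hL t φ ψ
    x y z (fun i j l s h => (hmatch i j l).1 ⟨s, h⟩) hdiag tt tt
  have hcard' : (Fintype.card ι : ℝ) ≤
      (Fintype.card {e : ιC → Fin p // ∑ a, (e a : ℕ) * C.W a < tt} : ℝ) +
      (Fintype.card {e : ιC → Fin p // ∑ a, (e a : ℕ) * C.W a < tt} : ℝ) +
      (Fintype.card {e : ιC → Fin p // tt + tt ≤ ∑ a, (e a : ℕ) * C.W a} : ℝ) := by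
    exact_mod_cast hcard
  -- `ρ^{|ιC|} p^{|ιC|} = |S|^{1-δ}`
  have hS : (Fintype.card S : ℝ) = (p : ℝ) ^ Fintype.card ιC := by
    rw [← Nat.card_eq_fintype_card, C.card_eq]; push_cast; rfl
  have hkey : ρ ^ Fintype.card ιC * (p : ℝ) ^ Fintype.card ιC =
      (Fintype.card S : ℝ) ^ (1 - δ) := by
    rw [hS]
    have hp0 : (0 : ℝ) < p := by linarith
    have hρp : ρ = (p : ℝ) ^ (-δ) := by
      rw [Real.rpow_def_of_pos hp0, hδ]
      have : Real.log p * -(-Real.log ρ / Real.log p) = Real.log ρ := by field_simp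
      rw [this, Real.exp_log hρ0]
    rw [hρp, ← Real.rpow_natCast, ← Real.rpow_natCast, ← Real.rpow_mul hp0.le,
      ← Real.rpow_mul hp0.le, ← Real.rpow_add hp0]
    congr 1; ring
  calc (Fintype.card ι : ℝ) ≤ _ := hcard'
    _ ≤ ρ ^ Fintype.card ιC * (p : ℝ) ^ Fintype.card ιC +
        ρ ^ Fintype.card ιC * (p : ℝ) ^ Fintype.card ιC +
        ρ ^ Fintype.card ιC * (p : ℝ) ^ Fintype.card ιC := by gcongr
    _ = 3 * (Fintype.card S : ℝ) ^ (1 - δ) := by rw [← hkey]; ring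

/-- **Realizations of `⟨n,n,n⟩` in translation schemes with arbitrary multiplier group have small
induced matchings.** With the `δ > 0` of `exists_autTwistedMatching_card_le`: if `S` is a finite
abelian group of exponent `p`, `(φ_s, ψ_s)` a finite family of automorphism pairs and
`α, β, γ : [n]² → S` realize `⟨n,n,n⟩` for the twisted triangle predicate in the sense of
Cohn–Umans 2013, Def. 12 (`(∃ s, α(x) φ_s(β(y)) ψ_s(γ(z)) = 1) ⟺ x.2 = y.1 ∧ z = (y.2, x.1)`),
then every induced matching `(a_i, b_i, c_i)_{i ∈ ι}` of the support of `⟨n,n,n⟩` has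
`|ι| ≤ 3 |S|^{1-δ}`. Since that support has induced matchings of size `n^{2-o(1)}`, a
translation scheme `𝒮(𝔽_p^k, M₀)` realizes `⟨n,n,n⟩` only if `n^{2-o(1)} ≤ 3 p^{(1-δ_p)k}` —
uniformly in `M₀ ≤ GL_k(𝔽_p)` (sharpest-statement §2y(8), Theorem B″). [this work] -/
theorem realization_autTwisted_inducedMatching_card_le (p : ℕ) [Fact p.Prime] :
    ∃ δ : ℝ, 0 < δ ∧ ∀ (S : Type) [CommGroup S] [Fintype S] [DecidableEq S],
      (∀ g : S, g ^ p = 1) →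
      ∀ (σ : Type) [Fintype σ] (φ ψ : σ → S ≃* S) (n : ℕ) (α β γ : Fin n × Fin n → S),
      (∀ x y z : Fin n × Fin n, (∃ s : σ, α x * φ s (β y) * ψ s (γ z) = 1) ↔
          (y.1 = x.2 ∧ z = (y.2, x.1))) →
      ∀ (ι : Type) [Fintype ι] (a b c : ι → Fin n),
        (∀ i j l : ι, b j = b i → c l = c j → a l = a i → i = j ∧ j = l) →
        (Fintype.card ι : ℝ) ≤ 3 * (Fintype.card S : ℝ) ^ (1 - δ) := by
  obtain ⟨δ, hδ0, hmain⟩ := exists_autTwistedMatching_card_le p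
  refine ⟨δ, hδ0, fun S _ _ _ hexpS σ _ φ ψ n α β γ hreal ι _ a b c hind => ?_⟩
  refine hmain S hexpS σ φ ψ ι (fun i => α (a i, b i)) (fun j => β (b j, c j))
    (fun l => γ (c l, a l)) fun i j l => ?_
  rw [hreal (a i, b i) (b j, c j) (c l, a l)]
  constructor
  · rintro ⟨h1, h2⟩
    simp only [Prod.mk.injEq] at h2
    exact hind i j l h1 h2.1 h2.2
  · rintro ⟨rfl, rfl⟩
    exact ⟨rfl, rfl⟩

end WeightFree

end Summit.MatrixMultiplication.MatrixMultiplication.Theorems.TwistedSliceRank
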